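import Summits.MatrixMultiplication.MatrixMultiplication.Theorems.ObstructionDescentPropagatedParity

set_option linter.dupNamespace false

/-!
# Unit twin blocks: odd levels die at every point `x ⊞ a·e ⊞ b·e` (decomp-mm · lens 3 · gen 14, part E)

Route `route-MatrixMultiplication-ObstructionDescent`, support for the aside `InvariantSaturation` (item
`stmt-MatrixMultiplication-32282`); continues `ObstructionDescentPropagatedParity` (law (PP), part D).

Part D proves the propagated-parity law at twin blocks of odd size `N₂` under ONE hypothesis: the weight-vector
space of the block type `((k^{N₂}))³`, degree `k N₂`, is a line.  For `N₂ = 1` that hypothesis is a THEOREM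
(`eq_smul_X_pow_of_mem_hwvSpace_one`): a `((k^1))³`-weight vector of degree `d` is a multiple of `x_{ℓℓℓ}^d`,
`ℓ = m - 1` — by the LOCALITY of weight vectors (`evalT_eq_evalT_proj`, gen-8 kernel: a weight vector does not see,
in slot `s`, the coordinates of weight `0`) applied in the three slots, which gives `f(t) = f(cubeLast 1 t)`, plus
homogeneity `f(c • u) = c^d f(u)`; no representation theory.  Hence (`evalT_eq_zero_of_twinUnits`,
`not_mem_pointLevels_of_twinUnits`): for `k` odd and any format `2 ≤ N ≤ m`, every `((k^N))³`-weight vector of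
degree `kN` vanishes at every `u ∈ twinDiag m 1` (shape `x ⊞ a·e ⊞ b·e`: entries supported on the three cubes of
`[0, m-2) ⊔ {m-2} ⊔ {m-1}`), and `k ∉ E′_N(u)`.  This contains the parity half of BI17 Thm 5.3 at
`⟨N⟩ = ⟨N-2⟩ ⊞ e ⊞ e` and turns the census's exact zeros `H₅(3³ ⊕ 1 ⊕ 1) = 0` into a theorem for every `w ⊞ e ⊞ e`.
[cite: BurgisserIkenmeyer2011, §3.1–3.2] (weight vectors as Borel eigenvectors), [cite: BurgisserIkenmeyer2017, §5 (5.2), Thm 5.3]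
(the level sets `E′` and the parity of `⟨N⟩`).
-/

open scoped BigOperators
open Finset

namespace Summit.MatrixMultiplication.MatrixMultiplication.Theorems.ObstructionCalculus

open Literature.Computability.AlgebraicComplexity (actTensor eval_smul_of_isHomogeneous)

section UnitTwins

variable {m : ℕ}


/-- The last index `ℓ = m - 1`. [bookkeeping] -/
def lastIdx (hm : 0 < m) : Fin m := ⟨m - 1, by omega⟩

/-- LOCALITY at the unit block: a `((k^1))³`-weight vector sees only the coordinate `x_{ℓℓℓ}`:
`f(t) = f(cubeLast 1 t)` (three applications of `evalT_eq_evalT_proj`). [this node] -/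
theorem evalT_eq_evalT_cubeLast_one {k d : ℕ} {f : MvPolynomial (Idx m) ℂ} (hf : f ∈ hwvSpace (rectType m 1 k) d)
    (t : Tensor ℂ m) : evalT t f = evalT (cubeLast 1 t) f := by
  classical
  have hT : ∀ s : Fin 3, ∀ a, a ∉ Finset.univ.filter (fun a : Fin m => m ≤ (a : ℕ) + 1) → rectType m 1 k s a = 0 := by
    intro s a ha
    rw [Finset.mem_filter] at ha
    simp only [rectType, if_neg (fun h => ha ⟨Finset.mem_univ a, h⟩)]
  rw [evalT_eq_evalT_proj hf 0 (hT 0), evalT_eq_evalT_proj hf 1 (hT 1), evalT_eq_evalT_proj hf 2 (hT 2)]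
  have key : proj 2 (Finset.univ.filter fun a : Fin m => m ≤ (a : ℕ) + 1)
      (proj 1 (Finset.univ.filter fun a : Fin m => m ≤ (a : ℕ) + 1)
        (proj 0 (Finset.univ.filter fun a : Fin m => m ≤ (a : ℕ) + 1) t)) = cubeLast 1 t := by
    funext a b c
    simp only [proj, cubeLast, slot_zero, slot_one, slot_two, Finset.mem_filter, Finset.mem_univ, true_and]
    by_cases ha : m ≤ (a : ℕ) + 1 <;> by_cases hb : m ≤ (b : ℕ) + 1 <;> by_cases hc : m ≤ (c : ℕ) + 1 <;>
      simp [ha, hb, hc]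
  rw [key]

/-- The unit cube holds one coordinate: `cubeLast 1 t = t_{ℓℓℓ} • δ_{ℓℓℓ}`. [bookkeeping] -/
theorem cubeLast_one_eq_smul (hm : 0 < m) (t : Tensor ℂ m) :
    cubeLast 1 t = t (lastIdx hm) (lastIdx hm) (lastIdx hm) • cubeLast 1 (fun _ _ _ => (1 : ℂ)) := by
  funext a b c
  simp only [cubeLast, Pi.smul_apply, smul_eq_mul]
  split_ifs with h
  · have ha : a = lastIdx hm := Fin.ext (by simp only [lastIdx]; omega)
    have hb : b = lastIdx hm := Fin.ext (by simp only [lastIdx]; omega)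
    have hc : c = lastIdx hm := Fin.ext (by simp only [lastIdx]; omega)
    rw [ha, hb, hc, mul_one]
  · rw [mul_zero]

/-- Homogeneity on tensors: `f(c • u) = c^d f(u)`. [bookkeeping] -/
theorem evalT_smul_tensor {d : ℕ} {f : MvPolynomial (Idx m) ℂ} (hf : f.IsHomogeneous d) (c : ℂ) (u : Tensor ℂ m) :
    evalT (c • u) f = c ^ d * evalT u f := by
  have key := eval_smul_of_isHomogeneous hf c (fun p : Idx m => u p.1 p.2.1 p.2.2)
  rw [eval_eq_evalT, eval_eq_evalT] at key
  convert key using 3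
  funext a b c'
  simp only [Pi.smul_apply, smul_eq_mul]

/-- **The block line for `N₂ = 1`.**  Every `((k^1))³`-weight vector of degree `d` is a multiple of `x_{ℓℓℓ}^d`
(locality + homogeneity; no representation theory). [this node] -/
theorem eq_smul_X_pow_of_mem_hwvSpace_one (hm : 0 < m) {k d : ℕ} {f : MvPolynomial (Idx m) ℂ}
    (hf : f ∈ hwvSpace (rectType m 1 k) d) :
    f = evalT (cubeLast 1 fun _ _ _ => (1 : ℂ)) f •
      MvPolynomial.X ((lastIdx hm, lastIdx hm, lastIdx hm) : Idx m) ^ d := by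
  apply MvPolynomial.funext
  intro x
  rw [MvPolynomial.smul_eval, map_pow, MvPolynomial.eval_X, eval_eq_evalT, evalT_eq_evalT_cubeLast_one hf,
    cubeLast_one_eq_smul hm, evalT_smul_tensor hf.1, mul_comm]

/-- Hence the hypothesis of `evalT_eq_zero_of_twinBlocks` holds for free at `N₂ = 1`. [this node] -/
theorem hwvSpace_one_line (hm : 0 < m) (k : ℕ) :
    ∀ f' ∈ hwvSpace (rectType m 1 k) (k * 1), ∃ c : ℂ,
      f' = c • MvPolynomial.X ((lastIdx hm, lastIdx hm, lastIdx hm) : Idx m) ^ (k * 1) :=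
  fun _ hf' => ⟨_, eq_smul_X_pow_of_mem_hwvSpace_one hm hf'⟩

/-- **(PP) at unit twin blocks, hypothesis-free.**  An ODD-level weight vector of any format `N` with `2 ≤ N ≤ m`
vanishes at every point `x ⊞ a·e ⊞ b·e` (entries supported on the three cubes of `[0, m-2) ⊔ {m-2} ⊔ {m-1}`).
[this node] -/
theorem evalT_eq_zero_of_twinUnits {N k : ℕ} (h2 : 2 ≤ N) (hNm : N ≤ m) (hk : Odd k)
    {f : MvPolynomial (Idx m) ℂ} (hf : f ∈ hwvSpace (rectType m N k) (k * N)) {u : Tensor ℂ m}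
    (hu : u ∈ twinDiag m 1) : evalT u f = 0 :=
  evalT_eq_zero_of_twinBlocks (N₂ := 1) (by omega) hNm hk odd_one hf (hwvSpace_one_line (by omega) k) hu

/-- Hence NO odd level at such points: `k` odd ⟹ `k ∉ E′_N(x ⊞ a·e ⊞ b·e)` — e.g. `⟨N⟩ = ⟨N-2⟩ ⊞ e ⊞ e`
(BI17 Thm 5.3's parity) and `w ⊞ e ⊞ e` for ANY `w` (the census's zeros `H₅(3³ ⊕ 1 ⊕ 1) = 0`). [this node] -/
theorem not_mem_pointLevels_of_twinUnits {N k : ℕ} (h2 : 2 ≤ N) (hNm : N ≤ m) (hk : Odd k) {u : Tensor ℂ m}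
    (hu : u ∈ twinDiag m 1) : k ∉ pointLevels N u := by
  rintro ⟨f, hf, hne⟩
  exact hne (evalT_eq_zero_of_twinUnits h2 hNm hk hf hu)

end UnitTwins

end Summit.MatrixMultiplication.MatrixMultiplication.Theorems.ObstructionCalculus
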